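import Summits.BirchSwinnertonDyer.BirchSwinnertonDyer.Theorems.CyclotomicUntwistPSTwistInvolution
import Summits.BirchSwinnertonDyer.BirchSwinnertonDyer.Theorems.CyclotomicUntwistPSUntwistingCharacterParity
import Summits.BirchSwinnertonDyer.BirchSwinnertonDyer.Theorems.CyclotomicUntwistFiniteSlopeSeparatedPinned
import Literature.NumberTheory.Congruences.QuadraticCharactersMinusThreeAndFive
import Literature.NumberTheory.EllipticCurves.QuadraticTwistProofs
import HarnessLib

/-!
# LAW L-tw3, character layer: `η₆ = η₃ · χ₋₃` for the untwisting characters mod `9` of route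
# `CyclotomicUntwist`, the matching `orderOf η = #Φ` transported across the `χ₋₃`-twist pair, and
# `a_p(E ⊗ χ₋₃) = η³(p) · a_p(E)`

Cell `pub/bsd-wall` (D-0145 line `route-BirchSwinnertonDyer-CyclotomicUntwist`), seat `bsd-line-cycu-p4`
(width seat 4, gen 5). Helper toward the cruxes K1 `PSRankOneLowerHalfAtThree`
(stmt-BirchSwinnertonDyer-21580) and K2 `PSRankOneUpperHalfAtThree` (stmt-21581). THEOREMS ONLY (no
definition, no named fact, no `sorry`); BSD is not proved by this file and no crux is. Fourth file of
LAW L-tw3 (`…PSTwistInvolutionKodaira`, `…UnitPart`, `…PSTwistInvolution`: on the cyclic wild cell at `3`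
the `±3`-twist is the involution `II 4 ↔ IV* 10`, `IV 6 ↔ II* 12`, PS row ↦ PS row, `W₃ ↦ −W₃`, Kraus order
`3 ↔ 6`, `N` fixed). Here the same involution is read in D1's currency, Dirichlet characters
`η : DirichletCharacter ℂ_[3] (3 ^ 2)` (the route untwists `f_E` by a PRIMITIVE `η` mod `9` whose order is
Kraus's inertia order `#Φ ∈ {3, 6}` — the tree's matching shadow `orderOf η = krausInertiaOrderThree W`,
`PSUntwistingCharacterParity.eta_neg_one_eq_rootNumberThree_of_psRow`).

* §1 Characters mod `9` with values in `ℂ₃`: `η⁶ = 1` (`pow_six_eq_one`), hence **`η = η⁴ · η³`**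
  (`eq_pow_four_mul_pow_three`). For `η` primitive of ORDER `6`: `η⁴` has order `3`, is EVEN and PRIMITIVE
  (`orderOf_pow_four`, `even_pow_four`, `isPrimitive_pow_four`); `η³` has order `2`, is ODD, and FACTORS
  THROUGH `3` (`orderOf_pow_three`, `odd_pow_three`, `factorsThrough_three_pow_three`) with values
  **`η³(n) = +1` if `n ≡ 1 (mod 3)`, `−1` if `n ≡ 2 (mod 3)`** (`pow_three_apply_natCast`): `η³` is the
  quadratic character `χ₋₃` of `ℚ(√−3) = ℚ(ζ₃)` read mod `9`. So `η₆ = η₃ · χ₋₃` with `η₃ := η⁴`. Conversely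
  `η₃ · ω` is primitive of order `6` for `η₃` primitive of order `3` and `ω` of order `2`
  (`orderOf_mul_of_orderOf_three_of_orderOf_two`, `isPrimitive_mul_of_orderOf_three_of_orderOf_two`).
* §2 **The matching passes to the twist partner** (`V` on a PS row of K1/K2, `C • V^{(±3)} = W` globally
  minimal): if `η` primitive matches `V` with `orderOf η = #Φ(V) = 6` (`IV`/`IV*`), then `η⁴` is primitive and
  matches `W` (`#Φ(W) = 3`), with `η(−1) = W₃(V) = −1` and `η⁴(−1) = W₃(W) = +1`
  (`matching_twist_of_orderOf_eq_six`); if `orderOf η = #Φ(V) = 3` (`II`/`II*`), then `η · ω` matches `W` for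
  every `ω` of order `2` (`matching_twist_of_orderOf_eq_three`).
* §3 **`a_p(E ⊗ χ₋₃) = (−3/p)·a_p(E) = η³(p)·a_p(E)`** for good `p > 3`: the tree's twisting formula
  `frobeniusTrace_quadraticTwist_holds` (Knapp Prop. 12.10) at `d = −3`, Hardy–Wright Thm 96
  (`SmallQuadraticResidues.isSquare_neg_three_iff`: `(−3/p) = +1` iff `p ≡ 1 (mod 6)`), and §1
  (`frobeniusTrace_twist_negThree`, `frobeniusTrace_twist_negThree_eq_pow_three_apply`).

READING (informal, not asserted). With `η₆ = η₃ · η₆³` and `a_p(E ⊗ χ₋₃) = η₆³(p) a_p(E)`: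
`f_E ⊗ η̄₆ = (f_E ⊗ η̄₆³) ⊗ η̄₃ = f_{E ⊗ χ₋₃} ⊗ η̄₃` coefficientwise away from `3` — a twist pair shares ONE
untwist newform `g` of level `9M` (`N(E ⊗ χ₋₃) = N(E)`, file 3), hence one `α = a₃(g)`, and D1's objects
`𝓛^{η₆}_E`, `𝓛^{η₃}_{E ⊗ χ₋₃}` are the odd / even branches of one Mazur–Tate–Teitelbaum distribution of `g`.
The newform-level identity itself (modularity, strong multiplicity one) is NOT claimed here.

References: L. C. Washington, *Introduction to Cyclotomic Fields*, GTM 83, Ch. 3 [Washington1997];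
A. W. Knapp, *Elliptic Curves* (1992) Prop. 12.10 [Knapp1993]; G. H. Hardy, E. M. Wright, *An Introduction
to the Theory of Numbers*, Thm 96 [HardyWright2008]; A. Kraus, Manuscripta Math. 69 (1990) [Kraus1990];
O. G. Rizzo, Compositio Math. 136 (2003), Table II [Rizzo2003]; B. Mazur, J. Tate, J. Teitelbaum, Invent.
Math. 84 (1986) §I.14 [MazurTateTeitelbaum1986Invent].
-/

open scoped Classical

open WeierstrassCurve IsDedekindDomain DirichletCharacter Literature.NumberTheory.EllipticCurves
  Literature.NumberTheory.EllipticCurves.Rank1Residual Literature.NumberTheory.DiophantineGeometry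
  Summit.BirchSwinnertonDyer.Rank1Residual.Additive
  Summit.BirchSwinnertonDyer.BirchSwinnertonDyer.Theorems

set_option linter.dupNamespace false -- single-conjunct summit: the name repeats by design
set_option autoImplicit false

noncomputable section

namespace Summit.BirchSwinnertonDyer.BirchSwinnertonDyer.Theorems.PSTwistInvolution

/-! ### §1 Characters mod `9`: `η = η⁴ · η³`, and the two factors of an order-`6` character -/

section Characters

variable (η : DirichletCharacter ℂ_[3] (3 ^ 2))

/-- `η⁶ = 1` for every character mod `9` with values in `ℂ₃` (`η(2)⁶ = 1` and a character mod `9` is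
determined by its value at the generator `2`). [cite: Washington1997, Ch. 3 (characters mod pⁿ)] -/
theorem pow_six_eq_one : η ^ 6 = 1 := by
  obtain ⟨-, -, -, -, -, -, e6⟩ := CyclotomicUntwistValueAtOne.eta_table η
  exact (PSUntwistingCharacterParity.pow_eq_one_iff_apply_two η 6).mpr e6

/-- **`η = η⁴ · η³`** for every character mod `9` with values in `ℂ₃` (`η⁷ = η`): the untwisting character
is the product of its "cubic part" `η⁴` and its "quadratic part" `η³`. [cite: Washington1997, Ch. 3] -/
theorem eq_pow_four_mul_pow_three : η = η ^ 4 * η ^ 3 := by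
  rw [← pow_add, show 4 + 3 = 6 + 1 by norm_num, pow_add, pow_six_eq_one, one_mul, pow_one]

/-- `η(−1)⁴ = 1`: the cubic part `η⁴` is EVEN, for every `η`. [folklore] -/
theorem even_pow_four : (η ^ 4).Even := by
  show (η ^ 4) (-1) = 1
  have h : ((-1 : ZMod (3 ^ 2))) = ↑((-1 : (ZMod (3 ^ 2))ˣ)) := by simp
  rw [h, MulChar.pow_apply_coe, ← h]
  rcases PSUntwistingCharacterParity.eta_neg_one_eq_one_or η with h1 | h1 <;> rw [h1] <;> norm_num

/-- `η³(4) = η(2)⁶ = 1`: the quadratic part kills `4`. [folklore] -/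
theorem pow_three_apply_four : (η ^ 3) (4 : ZMod (3 ^ 2)) = 1 := by
  obtain ⟨-, -, e4, -, -, -, e6⟩ := CyclotomicUntwistValueAtOne.eta_table η
  have h4 : ((ZMod.unitOfCoprime 4 (by decide) : (ZMod (3 ^ 2))ˣ) : ZMod (3 ^ 2)) = 4 := rfl
  have h4' : ((4 : ℕ) : ZMod (3 ^ 2)) = 4 := by norm_num
  rw [← h4, MulChar.pow_apply_coe, h4, ← h4', e4, ← pow_mul]
  exact e6

/-- **The quadratic part `η³` FACTORS THROUGH `3`** (it is trivial on `ker((ℤ/9)ˣ → (ℤ/3)ˣ) = {1, 4, 7}`):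
it is a character of conductor dividing `3`. [cite: Washington1997, Ch. 3] -/
theorem factorsThrough_three_pow_three : (η ^ 3).FactorsThrough 3 := by
  rw [factorsThrough_iff_ker_unitsMap (hd := show 3 ∣ 3 ^ 2 by norm_num)]
  intro x hx
  rw [MonoidHom.mem_ker] at hx ⊢
  apply Units.ext
  rw [MulChar.coe_toUnitHom, Units.val_one]
  have h4 := pow_three_apply_four η
  rcases CyclotomicUntwistValueAtOne.coe_eq_of_unitsMap_eq_one x hx with h | h | h
  · rw [h, map_one]
  · rw [h]; exact_mod_cast h4
  · have h7 : ((7 : ℕ) : ZMod (3 ^ 2)) = (4 : ZMod (3 ^ 2)) * 4 := by decide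
    rw [h, h7, map_mul, h4, one_mul]

/-- **Values of the quadratic part: `η³(n) = +1` if `n ≡ 1 (mod 3)` and `−1` if `n ≡ 2 (mod 3)`** (`3 ∤ n`),
for `η` of order `6` (then `η(2)³ = −1`; the units `1, 4, 7` of `ℤ/9` are even powers of `2`, the units
`2, 5, 8` odd powers). So `η³` is the Kronecker character of `ℚ(√−3)` read modulo `9`.
[cite: Washington1997, Ch. 3] -/
theorem pow_three_apply_natCast (h6 : orderOf η = 6) (n : ℕ) (hn : ¬ 3 ∣ n) :
    (η ^ 3) (n : ZMod (3 ^ 2)) = if n % 3 = 1 then 1 else -1 := by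
  obtain ⟨e1, e2, e4, e5, e7, e8, e6⟩ := CyclotomicUntwistValueAtOne.eta_table η
  -- `η(2)³ = −1`: `η(2)³ = ±1`, and `+1` would make the order of `η(2)` divide `3`
  have hz3 : η 2 ^ 3 = -1 := by
    rcases PSUntwistingCharacterParity.eta_neg_one_eq_one_or η with h | h
    · exfalso
      rw [PSUntwistingCharacterParity.eta_neg_one_eq_pow_three] at h
      have hd : orderOf (η 2) ∣ 3 := orderOf_dvd_of_pow_eq_one h
      rw [← PSUntwistingCharacterParity.orderOf_eq_orderOf_apply_two, h6] at hd
      norm_num at hd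
    · rwa [PSUntwistingCharacterParity.eta_neg_one_eq_pow_three] at h
  -- `(η³)(m) = η(m)³` on units, and reduce `n` modulo `9`
  have hcube : ∀ m : ZMod (3 ^ 2), (η ^ 3) m = η m ^ 3 := fun m ↦ by
    by_cases hm : IsUnit m
    · obtain ⟨u, rfl⟩ := hm
      rw [MulChar.pow_apply_coe]
    · rw [MulChar.map_nonunit _ hm, MulChar.map_nonunit _ hm]; norm_num
  have hn9 : ((n % 9 : ℕ) : ZMod (3 ^ 2)) = n := ZMod.natCast_mod n 9
  have hmod3 : n % 3 = n % 9 % 3 := by omega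
  have hlt : n % 9 < 9 := Nat.mod_lt _ (by norm_num)
  have hne : n % 9 ≠ 0 ∧ n % 9 ≠ 3 ∧ n % 9 ≠ 6 := by omega
  rw [hcube, ← hn9, hmod3]
  obtain ⟨m, hm⟩ : ∃ m, n % 9 = m := ⟨_, rfl⟩
  rw [hm] at hlt hne ⊢
  interval_cases m
  · exact absurd rfl hne.1
  · rw [e1]; norm_num
  · rw [e2, hz3]; norm_num
  · exact absurd rfl hne.2.1
  · rw [e4, ← pow_mul, show 2 * 3 = 6 by norm_num, e6]; norm_num
  · rw [e5, ← pow_mul, show 5 * 3 = 6 * 2 + 3 by norm_num, pow_add, pow_mul, e6, one_pow, one_mul, hz3]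
    norm_num
  · exact absurd rfl hne.2.2
  · rw [e7, ← pow_mul, show 4 * 3 = 6 * 2 by norm_num, pow_mul, e6, one_pow]; norm_num
  · rw [e8, ← pow_mul, show 3 * 3 = 6 + 3 by norm_num, pow_add, e6, one_mul, hz3]; norm_num

variable {η}

/-- For `η` of order `6`: **the cubic part `η⁴` has order `3`** (`6 / gcd(6, 4)`). [folklore] -/
theorem orderOf_pow_four (h6 : orderOf η = 6) : orderOf (η ^ 4) = 3 := by
  rw [orderOf_pow' η (by norm_num), h6]; decide

/-- For `η` of order `6`: **the quadratic part `η³` has order `2`**. [folklore] -/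
theorem orderOf_pow_three (h6 : orderOf η = 6) : orderOf (η ^ 3) = 2 := by
  rw [orderOf_pow' η (by norm_num), h6]; decide

/-- For `η` PRIMITIVE of order `6`: the quadratic part `η³` is ODD (`η³(−1) = η(−1)³ = −1`).
[cite: Washington1997, Ch. 3] -/
theorem odd_pow_three (hη : η.IsPrimitive) (h6 : orderOf η = 6) : (η ^ 3).Odd := by
  show (η ^ 3) (-1) = -1
  have hodd : η (-1) = -1 := (PSUntwistingCharacterParity.odd_iff_orderOf_eq_six η hη).mpr h6
  have h : ((-1 : ZMod (3 ^ 2))) = ↑((-1 : (ZMod (3 ^ 2))ˣ)) := by simp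
  rw [h, MulChar.pow_apply_coe, ← h, hodd]; norm_num

/-- For `η` PRIMITIVE: **the cubic part `η⁴` is PRIMITIVE** (`η⁴(4) = η(2)⁸ = η(2)² ≠ 1`, and a character
mod `9` not killing `4` has conductor `9`). [cite: Washington1997, Ch. 3] -/
theorem isPrimitive_pow_four (hη : η.IsPrimitive) : (η ^ 4).IsPrimitive := by
  refine CyclotomicUntwistFiniteSlopeSeparatedPinned.isPrimitive_of_apply_four_ne_one _ ?_
  obtain ⟨-, -, e4, -, -, -, e6⟩ := CyclotomicUntwistValueAtOne.eta_table η
  have h4 : ((ZMod.unitOfCoprime 4 (by decide) : (ZMod (3 ^ 2))ˣ) : ZMod (3 ^ 2)) = 4 := rfl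
  have h4' : ((4 : ℕ) : ZMod (3 ^ 2)) = 4 := by norm_num
  rw [← h4, MulChar.pow_apply_coe, h4, ← h4', e4, ← pow_mul, show 2 * 4 = 6 + 2 by norm_num, pow_add, e6,
    one_mul]
  exact PSUntwistingCharacterParity.apply_two_sq_ne_one η hη

/-- Characters mod `9` commute (the group of Dirichlet characters is commutative). [folklore] -/
theorem commute (ω : DirichletCharacter ℂ_[3] (3 ^ 2)) : Commute η ω := mul_comm η ω

/-- **`η₃ · ω` has order `6`** for `η₃` of order `3` and `ω` of order `2` (coprime orders).
[folklore] -/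
theorem orderOf_mul_of_orderOf_three_of_orderOf_two (h3 : orderOf η = 3) {ω : DirichletCharacter ℂ_[3] (3 ^ 2)}
    (h2 : orderOf ω = 2) : orderOf (η * ω) = 6 := by
  rw [(commute ω).orderOf_mul_eq_mul_orderOf_of_coprime (by rw [h3, h2]; decide), h3, h2]

/-- **`η₃ · ω` is PRIMITIVE** for `η₃` primitive and `ω` of order `2` (`ω(4) = ω(2)² = 1`, so
`(η₃ω)(4) = η₃(4) ≠ 1`). [cite: Washington1997, Ch. 3] -/
theorem isPrimitive_mul_of_orderOf_two (hη : η.IsPrimitive) {ω : DirichletCharacter ℂ_[3] (3 ^ 2)}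
    (h2 : orderOf ω = 2) : (η * ω).IsPrimitive := by
  refine CyclotomicUntwistFiniteSlopeSeparatedPinned.isPrimitive_of_apply_four_ne_one _ ?_
  obtain ⟨-, -, e4, -, -, -, -⟩ := CyclotomicUntwistValueAtOne.eta_table ω
  have hω2 : ω 2 ^ 2 = 1 := by
    have h := pow_orderOf_eq_one ω
    rw [h2, PSUntwistingCharacterParity.pow_eq_one_iff_apply_two] at h
    exact h
  have h4' : ((4 : ℕ) : ZMod (3 ^ 2)) = 4 := by norm_num
  rw [MulChar.mul_apply, ← h4', e4, hω2, mul_one]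
  exact CyclotomicUntwistValueAtOne.eta_four_ne_one η hη

/-- **A character of order `2` mod `9` exists** in `ℂ₃` (`ω := η³` for any odd primitive `η`,
`CyclotomicUntwistFiniteSlopeSeparatedPinned.exists_isPrimitive_and_odd`). [folklore] -/
theorem exists_orderOf_eq_two : ∃ ω : DirichletCharacter ℂ_[3] (3 ^ 2), orderOf ω = 2 ∧ ω.Odd := by
  obtain ⟨η, hη, hodd⟩ := CyclotomicUntwistFiniteSlopeSeparatedPinned.exists_isPrimitive_and_odd
  have h6 : orderOf η = 6 := (PSUntwistingCharacterParity.odd_iff_orderOf_eq_six η hη).mp hodd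
  exact ⟨η ^ 3, orderOf_pow_three h6, odd_pow_three hη h6⟩

end Characters

/-! ### §2 The matching `orderOf η = #Φ` across the twist pair -/

section Matching

variable (V W : WeierstrassCurve ℚ) [V.IsElliptic] [V.IsGloballyMinimal] [W.IsElliptic] [W.IsGloballyMinimal]
  (η : DirichletCharacter ℂ_[3] (3 ^ 2))

/-- **Order `6` side ⟶ order `3` side.** `V` on a PS row of K1/K2 matched by a primitive `η` of order
`#Φ(V) = 6` (Kodaira `IV`/`IV*`), `C • V^{(±3)} = W` globally minimal: the cubic part `η⁴` is primitive and
matches the partner, `orderOf η⁴ = #Φ(W) = 3` (`II*`/`II`), and the signs read `η(−1) = W₃(V) = −1`,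
`η⁴(−1) = W₃(W) = +1`. [cite: Kraus1990, Théorème (p = 3)] [cite: Rizzo2003, Table II (p. 4)]
[cite: Washington1997, Ch. 3] -/
theorem matching_twist_of_orderOf_eq_six (hO6 : ClassO6 V 3)
    (hev : Even (padicValInt 3 V.minimalDiscriminantInt))
    (hps : V.minimalDiscriminantInt / 3 ^ padicValInt 3 V.minimalDiscriminantInt % 3 = 1)
    {d : ℤ} (hd : d = 3 ∨ d = -3) (C : VariableChange ℚ) (hC : C • V.quadraticTwist (d : ℚ) = W)
    (hη : η.IsPrimitive) (hmatch : orderOf η = krausInertiaOrderThree V) (h6 : orderOf η = 6) :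
    (η ^ 4).IsPrimitive ∧ orderOf (η ^ 4) = krausInertiaOrderThree W ∧ krausInertiaOrderThree W = 3 ∧
      η (-1) = (V.rootNumberThree : ℂ_[3]) ∧ V.rootNumberThree = -1 ∧
      (η ^ 4) (-1) = (W.rootNumberThree : ℂ_[3]) ∧ W.rootNumberThree = 1 := by
  have hkV : krausInertiaOrderThree V = 6 := hmatch ▸ h6
  have hkW : krausInertiaOrderThree W = 3 := by
    rcases krausInertiaOrderThree_twist_of_cyclic V W hO6 hev hd C hC with ⟨h, -⟩ | ⟨-, h⟩
    · rw [hkV] at h; norm_num at h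
    · exact h
  obtain ⟨hO6W, hevW, hpsW⟩ := psRow_twist_of_psRow V W hO6 hev hps hd C hC
  have hsV := PSUntwistingCharacterParity.eta_neg_one_eq_rootNumberThree_of_psRow V η hO6 hev hps hη hmatch
  have hprim := isPrimitive_pow_four hη
  have h3 := orderOf_pow_four h6
  have hsW := PSUntwistingCharacterParity.eta_neg_one_eq_rootNumberThree_of_psRow W (η ^ 4) hO6W hevW hpsW
    hprim (h3.trans hkW.symm)
  have hWV : W.rootNumberThree = -V.rootNumberThree := rootNumberThree_twist_of_psRow V W hO6 hev hps hd C hC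
  have hV1 : V.rootNumberThree = -1 :=
    (PSRootNumberThree.rootNumberThree_eq_neg_one_iff_krausInertiaOrderThree_of_psRow V hO6 hev hps).mpr hkV
  refine ⟨hprim, h3.trans hkW.symm, hkW, hsV, hV1, hsW, ?_⟩
  rw [hWV, hV1]; norm_num

/-- **Order `3` side ⟶ order `6` side.** `V` on a PS row matched by a primitive `η` of order `#Φ(V) = 3`
(`II`/`II*`), `C • V^{(±3)} = W`: for every character `ω` of order `2` mod `9` (the quadratic part), `η · ω` is
primitive and matches the partner, `orderOf (η ω) = #Φ(W) = 6` (`IV*`/`IV`), and `(ηω)(−1) = W₃(W) = −1`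
(so `ω` is necessarily odd). [cite: Kraus1990, Théorème (p = 3)] [cite: Rizzo2003, Table II (p. 4)]
[cite: Washington1997, Ch. 3] -/
theorem matching_twist_of_orderOf_eq_three (hO6 : ClassO6 V 3)
    (hev : Even (padicValInt 3 V.minimalDiscriminantInt))
    (hps : V.minimalDiscriminantInt / 3 ^ padicValInt 3 V.minimalDiscriminantInt % 3 = 1)
    {d : ℤ} (hd : d = 3 ∨ d = -3) (C : VariableChange ℚ) (hC : C • V.quadraticTwist (d : ℚ) = W)
    (hη : η.IsPrimitive) (hmatch : orderOf η = krausInertiaOrderThree V) (h3 : orderOf η = 3)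
    {ω : DirichletCharacter ℂ_[3] (3 ^ 2)} (h2 : orderOf ω = 2) :
    (η * ω).IsPrimitive ∧ orderOf (η * ω) = krausInertiaOrderThree W ∧ krausInertiaOrderThree W = 6 ∧
      (η * ω) (-1) = (W.rootNumberThree : ℂ_[3]) ∧ W.rootNumberThree = -1 ∧ V.rootNumberThree = 1 := by
  have hkV : krausInertiaOrderThree V = 3 := hmatch ▸ h3
  have hkW : krausInertiaOrderThree W = 6 := by
    rcases krausInertiaOrderThree_twist_of_cyclic V W hO6 hev hd C hC with ⟨-, h⟩ | ⟨h, -⟩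
    · exact h
    · rw [hkV] at h; norm_num at h
  obtain ⟨hO6W, hevW, hpsW⟩ := psRow_twist_of_psRow V W hO6 hev hps hd C hC
  have hprim := isPrimitive_mul_of_orderOf_two hη h2
  have h6 := orderOf_mul_of_orderOf_three_of_orderOf_two h3 h2
  have hsW := PSUntwistingCharacterParity.eta_neg_one_eq_rootNumberThree_of_psRow W (η * ω) hO6W hevW hpsW
    hprim (h6.trans hkW.symm)
  have hW1 : W.rootNumberThree = -1 :=
    (PSRootNumberThree.rootNumberThree_eq_neg_one_iff_krausInertiaOrderThree_of_psRow W hO6W hevW hpsW).mpr hkW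
  have hWV : W.rootNumberThree = -V.rootNumberThree := rootNumberThree_twist_of_psRow V W hO6 hev hps hd C hC
  refine ⟨hprim, h6.trans hkW.symm, hkW, hsW, hW1, ?_⟩
  have := hWV.symm.trans hW1
  linarith

end Matching

/-! ### §3 Frobenius traces: `a_p(E ⊗ χ₋₃) = (−3/p)·a_p(E) = η³(p)·a_p(E)` -/

section Traces

variable (V W : WeierstrassCurve ℚ) [V.IsElliptic] [V.IsGloballyMinimal] [W.IsElliptic] [W.IsGloballyMinimal]

/-- `(−3/p) = +1` if `p ≡ 1 (mod 3)` and `−1` if `p ≡ 2 (mod 3)`, for a prime `p > 3` (Hardy–Wright Thm 96,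
tree `SmallQuadraticResidues.isSquare_neg_three_iff`). [cite: HardyWright2008, Thm 96] -/
theorem legendreSym_neg_three_eq_ite (p : ℕ) [Fact p.Prime] (hp3 : 3 < p) :
    legendreSym p (-3) = if p % 3 = 1 then 1 else -1 := by
  have hp := (Fact.out : p.Prime)
  have hodd : p % 2 = 1 := (Nat.Prime.mod_two_eq_one_iff_ne_two hp).mpr (by omega)
  have hne : ((-3 : ℤ) : ZMod p) ≠ 0 := by
    rw [Ne, ZMod.intCast_zmod_eq_zero_iff_dvd]
    intro h
    have h' : (p : ℤ) ∣ ((3 : ℕ) : ℤ) := by rw [Nat.cast_ofNat]; exact dvd_neg.mp h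
    have h3 : p = 3 :=
      (Nat.prime_dvd_prime_iff_eq hp Nat.prime_three).mp (Int.natCast_dvd_natCast.mp h')
    omega
  have hiff := Literature.NumberTheory.Congruences.SmallQuadraticResidues.isSquare_neg_three_iff (p := p) hp3
  have hcast : ((-3 : ℤ) : ZMod p) = (-3 : ZMod p) := by norm_num
  by_cases h1 : p % 3 = 1
  · rw [if_pos h1, legendreSym.eq_one_iff p hne, hcast]
    exact hiff.mpr (by omega)
  · rw [if_neg h1, legendreSym.eq_neg_one_iff p, hcast]
    intro h
    exact h1 (by have := hiff.mp h; omega)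

omit [W.IsElliptic] in
/-- **`a_p(E ⊗ χ₋₃) = (−3/p) · a_p(E)`** on globally minimal models: for `C • V^{(−3)} = W` and a prime `p > 3`
of good reduction for `V`, `W.frobeniusTrace p = (if p ≡ 1 (mod 3) then 1 else −1) · V.frobeniusTrace p`
(tree `frobeniusTrace_quadraticTwist_holds`, Knapp Prop. 12.10, at the squarefree `d = −3`).
[cite: Knapp1993, Prop. 12.10 (PDF pp. 302–303)] [cite: HardyWright2008, Thm 96] -/
theorem frobeniusTrace_twist_negThree (C : VariableChange ℚ) (hC : C • V.quadraticTwist ((-3 : ℤ) : ℚ) = W)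
    (p : ℕ) [Fact p.Prime] (hp3 : 3 < p) (hgood : ¬ (p : ℤ) ∣ V.minimalDiscriminantInt) :
    W.frobeniusTrace p = (if p % 3 = 1 then 1 else -1) * V.frobeniusTrace p := by
  have hsf : Squarefree (-3 : ℤ) := by
    rw [← Int.squarefree_natAbs]; exact Nat.prime_three.squarefree
  have hp := (Fact.out : p.Prime)
  have hpd : ¬ (p : ℤ) ∣ 2 * (-3) := by
    intro h
    have h6 : p ∣ 2 * 3 := by
      have : (p : ℤ) ∣ ((6 : ℕ) : ℤ) := by simpa using h
      exact Int.natCast_dvd_natCast.mp this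
    rcases (Nat.Prime.dvd_mul hp).mp h6 with h2 | h3
    · have := (Nat.prime_dvd_prime_iff_eq hp Nat.prime_two).mp h2; omega
    · have := (Nat.prime_dvd_prime_iff_eq hp Nat.prime_three).mp h3; omega
  have h := frobeniusTrace_quadraticTwist_holds V W (-3) hsf ⟨C⁻¹, by rw [← hC, inv_smul_smul]⟩ p hpd hgood
  rw [h, legendreSym_neg_three_eq_ite p hp3]

omit [W.IsElliptic] in
/-- **`a_p(E ⊗ χ₋₃) = η³(p) · a_p(E)` in D1's currency**: for `η` a character mod `9` of order `6` (the
untwisting character on the `IV`/`IV*` member of the pair), `C • V^{(−3)} = W`, and a prime `p > 3` good for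
`V`: `a_p(W) = η³(p) · a_p(V)` in `ℂ₃`. With `η = η⁴·η³` (§1): the `η`-twist of `f_V` and the `η⁴`-twist of
`f_W` have the same `p`-th coefficients — one untwist `g` per pair (coefficientwise, away from `3`).
[cite: Knapp1993, Prop. 12.10] [cite: Washington1997, Ch. 3] [cite: MazurTateTeitelbaum1986Invent, §I.14] -/
theorem frobeniusTrace_twist_negThree_eq_pow_three_apply (η : DirichletCharacter ℂ_[3] (3 ^ 2))
    (h6 : orderOf η = 6) (C : VariableChange ℚ) (hC : C • V.quadraticTwist ((-3 : ℤ) : ℚ) = W)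
    (p : ℕ) [Fact p.Prime] (hp3 : 3 < p) (hgood : ¬ (p : ℤ) ∣ V.minimalDiscriminantInt) :
    (W.frobeniusTrace p : ℂ_[3]) = (η ^ 3) (p : ZMod (3 ^ 2)) * V.frobeniusTrace p := by
  have hp := (Fact.out : p.Prime)
  have h3 : ¬ 3 ∣ p := fun h ↦ by
    have := (Nat.prime_dvd_prime_iff_eq Nat.prime_three hp).mp h; omega
  rw [frobeniusTrace_twist_negThree V W C hC p hp3 hgood, pow_three_apply_natCast η h6 p h3]
  push_cast
  split_ifs <;> simp

end Traces

end Summit.BirchSwinnertonDyer.BirchSwinnertonDyer.Theorems.PSTwistInvolution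

end
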